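import Literature.AlgebraicGeometry.HodgeTheory.SimpleOddPrimeDimensionHodgeClasses
import Literature.AlgebraicGeometry.HodgeTheory.RibetTypeTwoOddPowersHodgeClasses
import HarnessLib

/-!
# Simple complex abelian varieties of odd prime dimension `p`: `B•(Xⁿ) = D•(Xⁿ)` outside the generic shape `End⁰ = ℚ` and the unitary shapes with both multiplicities `≥ 3` — the case `p = 7`: every simple sevenfold except `End⁰ = ℚ` and `k`-signature `(3,4)`/`(4,3)` (Tankeev–Ribet; Ribet 1983 Thm. 3 at `(2, p − 2)`; Moonen–Zarhin 1999 Thm. (2.7))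

Family `hodge`, layer `Literature/AlgebraicGeometry/HodgeTheory`. Research context: cell `pub-hodge-ring2` (HONEST
FRAMING: research route conditional on HC_CM; not a corollary; Q11.4-sentence-2 already refuted in dim ≥ 3), Literature
lane (lit gen 83, programme R61). Theorems only (no definition, no named fact, D-0026; nothing admitted). Sequel of the
tree's `SimpleOddPrimeDimensionHodgeClasses` (§2: `B = D` on all powers of a simple `X` of odd prime dimension GRANTED the
two residual shapes (S1) `End⁰ = ℚ` and (S2) `End⁰ = k` imaginary quadratic with both multiplicities `≥ 2`): with the
tree's UNCONDITIONAL `AbelianVariety.isDivisorGenerated_powSucc_of_ribetTypeTwoOdd` (Ribet's Thm. 3 at multiplicities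
`(2, p − 2)`, `p` odd — `RibetTypeTwoOddPowersHodgeClasses`, resting on the Hermitian core `UnitaryTwoOdd.eq_top`) the
shape (S2) shrinks to (S2′): both multiplicities `≥ 3`. For `p = 7` the residual unitary shape is the single signature
pair `(3,4)`/`(4,3)`.

PRINTED RESULTS. Moonen–Zarhin, Math. Ann. 315 (1999), Thm. (2.7): «Let `X` be a simple complex abelian variety such that
`dim(X)` is a prime number. Then `Hg(X) = Sp_D(V,φ)` and `B•(Xⁿ) = D•(Xⁿ)` for every `n ≥ 1`» (Tankeev; Ribet). Gordon,
*Survey*, Thm. 6.3 (Ribet 1983 Thms. 1–3) and its Corollary (prime dimension).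

THIS FILE.
* §1 **`isDivisorGenerated_powSucc_of_isSimple_of_prime_of_odd_of_ge_three`** — `B•(X^{N+1}) = D•(X^{N+1})` for `X`
  simple of odd prime dimension GRANTED (S1) and (S2′) as pointwise hypotheses; `tankeevRibet1983_iff_generic_and_unitary_ge_three`
  — the Tankeev–Ribet named fact is EQUIVALENT to (S1) ∧ (S2′).
* §2 `p = 7`: **`isDivisorGenerated_powSucc_of_isSimple_sevenfold`** (granted (S1) and the `(3,4)`/`(4,3)` shape),
  **`hodgeConjectureFor_powSucc_of_isSimple_sevenfold`** — THE HODGE CONJECTURE FOR ALL POWERS OF EVERY SIMPLE COMPLEX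
  ABELIAN SEVENFOLD whose `End⁰` is not `ℚ` and which is not of unitary type with `k`-signature `(3,4)`/`(4,3)`,
  UNCONDITIONAL.
NOT claimed: the shapes (S1) (`Hg = Sp_{14}`) and `(3,4)`/`(4,3)` themselves.

## References
* [MoonenZarhin1999LowDim] B. Moonen, Yu. Zarhin, Math. Ann. 315 (1999), §2 (2.4) and Thm. (2.7).
* [Gordon1997] B. B. Gordon, *A survey of the Hodge conjecture for abelian varieties*, Thm. 6.3 and Corollary, §1.13.3.
* [Ribet1983] K. A. Ribet, Amer. J. Math. 105 (1983), Thms. 0–3.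
* [Pohlmann1968] H. Pohlmann, Ann. of Math. 88 (1968), Thm. 1.
* [vanGeemen1994HodgeAV] B. van Geemen, LNM 1594 (1994), §2.4.
* [Deligne2000] P. Deligne, *The Hodge conjecture* (Clay problem statement), §1.
-/

noncomputable section

open CategoryTheory Module NumberField

namespace Literature.AlgebraicGeometry.HodgeTheory

open Literature.AlgebraicGeometry.Motives Literature.AlgebraicGeometry.ComplexMultiplication
open Literature.Barriers.HodgeConjecture (divisorClassesSpan)

variable {X : AbelianVariety ℂ}

/-! ### §1 Odd prime dimension: the unitary residual shape shrinks to multiplicities `≥ 3` -/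

/-- **`B•(X^{N+1}) = D•(X^{N+1})` for `X` simple of odd prime dimension, GRANTED (S1) `End⁰ = ℚ` and (S2′) the unitary
shape with BOTH multiplicities `≥ 3`** (pointwise hypotheses `h1`, `h3`). The unitary shape with a multiplicity equal to
`2` is the tree's unconditional `AbelianVariety.isDivisorGenerated_powSucc_of_ribetTypeTwoOdd` (`dim X` odd); the
other shapes as in `isDivisorGenerated_powSucc_of_isSimple_of_prime_of_odd`.
[cite: MoonenZarhin1999LowDim, §2 (2.4) and Thm. (2.7)] [cite: Gordon1997, Thm. 6.3 and Corollary] [cite: Ribet1983, Thms. 0–3]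
[cite: Pohlmann1968, Thm. 1] -/
theorem isDivisorGenerated_powSucc_of_isSimple_of_prime_of_odd_of_ge_three (hs : X.IsSimple) (hp : X.dim.Prime)
    (hodd : Odd X.dim)
    (h1 : Module.finrank ℚ X.endAlgebra = 1 → ∀ N : ℕ, IsDivisorGenerated (X.powSucc N))
    (h3 : ∀ (φ : X ⟶ X) (d : ℕ), 0 < d → φ ≫ φ = -(d • 𝟙 X) → Module.finrank ℚ X.endAlgebra = 2 →
      3 ≤ eigenMultiplicity X φ (Complex.I * (Real.sqrt d : ℂ)) →
      3 ≤ eigenMultiplicity X φ (-(Complex.I * (Real.sqrt d : ℂ))) → ∀ N : ℕ, IsDivisorGenerated (X.powSucc N))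
    (N : ℕ) : IsDivisorGenerated (X.powSucc N) := by
  classical
  refine isDivisorGenerated_powSucc_of_isSimple_of_prime_of_odd hs hp hodd h1 (fun φ d hd hφ he2 ha hb N => ?_) N
  by_cases htwo : eigenMultiplicity X φ (Complex.I * (Real.sqrt d : ℂ)) = 2 ∨
      eigenMultiplicity X φ (-(Complex.I * (Real.sqrt d : ℂ))) = 2
  · exact AbelianVariety.isDivisorGenerated_powSucc_of_ribetTypeTwoOdd X φ hd hφ he2 hodd htwo N
  · simp only [not_or] at htwo
    exact h3 φ d hd hφ he2 (by omega) (by omega) N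

/-- **LOCALISATION OF THE TANKEEV–RIBET FACT, SHARPENED.** The tree's named fact
`TankeevRibet1983_hodgeClasses_divisorial_powers_simplePrimeDimension` is EQUIVALENT to the conjunction of (S1) simple `X`
of odd prime dimension with `End⁰(X) = ℚ`, and (S2′) simple `X` of prime dimension with `dim_ℚ End⁰(X) = 2`, `φ ≫ φ = -d`
and BOTH multiplicities `≥ 3` (the tree's `tankeevRibet1983_iff_generic_and_unitary_shapes` with (S2) narrowed by
`AbelianVariety.isDivisorGenerated_powSucc_of_ribetTypeTwoOdd`). [cite: MoonenZarhin1999LowDim, §2 Thm. (2.7)]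
[cite: Gordon1997, Thm. 6.3 and Corollary] [cite: Ribet1983, Thms. 1 and 3] -/
theorem tankeevRibet1983_iff_generic_and_unitary_ge_three :
    TankeevRibet1983_hodgeClasses_divisorial_powers_simplePrimeDimension ↔
      (∀ X : AbelianVariety ℂ, X.dim.Prime → Odd X.dim → X.IsSimple → Module.finrank ℚ X.endAlgebra = 1 →
        ∀ N : ℕ, IsDivisorGenerated (X.powSucc N)) ∧
      (∀ (X : AbelianVariety ℂ) (φ : X ⟶ X) (d : ℕ), X.dim.Prime → X.IsSimple → 0 < d → φ ≫ φ = -(d • 𝟙 X) →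
        Module.finrank ℚ X.endAlgebra = 2 → 3 ≤ eigenMultiplicity X φ (Complex.I * (Real.sqrt d : ℂ)) →
        3 ≤ eigenMultiplicity X φ (-(Complex.I * (Real.sqrt d : ℂ))) → ∀ N : ℕ, IsDivisorGenerated (X.powSucc N)) := by
  rw [tankeevRibet1983_iff_generic_and_unitary_shapes]
  refine ⟨fun ⟨hS1, hS2⟩ => ⟨hS1, fun X φ d hp hs hd hφ he2 ha hb N =>
    hS2 X φ d hp hs hd hφ he2 (by omega) (by omega) N⟩, fun ⟨hS1, hS3⟩ => ⟨hS1, ?_⟩⟩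
  intro X φ d hp hs hd hφ he2 ha hb N
  -- both multiplicities `≥ 2` in prime dimension: `p` is odd (`p = n' + n'' ≥ 4`)
  have hsum := eigenMultiplicity_add_eigenMultiplicity_neg_eq_dim X φ hd hφ
  have hp2 : X.dim ≠ 2 := by omega
  have hodd : Odd X.dim := hp.odd_of_ne_two hp2
  by_cases htwo : eigenMultiplicity X φ (Complex.I * (Real.sqrt d : ℂ)) = 2 ∨
      eigenMultiplicity X φ (-(Complex.I * (Real.sqrt d : ℂ))) = 2
  · exact AbelianVariety.isDivisorGenerated_powSucc_of_ribetTypeTwoOdd X φ hd hφ he2 hodd htwo N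
  · simp only [not_or] at htwo
    exact hS3 X φ d hp hs hd hφ he2 (by omega) (by omega) N

/-! ### §2 Dimension seven: every simple abelian sevenfold except `End⁰ = ℚ` and `k`-signature `(3,4)`/`(4,3)` -/

/-- **`B•(X^{N+1}) = D•(X^{N+1})` for every SIMPLE complex abelian SEVENFOLD, GRANTED ONLY the generic shape `End⁰(X) = ℚ`
(hypothesis `h1`) and the unitary shape of `k`-signature `(3,4)`/`(4,3)` (hypothesis `h34`)**: the signatures
`(1,6)`/`(6,1)` are the tree's type-one theorem, `(2,5)`/`(5,2)` the tree's
`AbelianVariety.isDivisorGenerated_powSucc_of_sevenfold_twoFive`, the totally real degree-`7` and CM shapes as in §1.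
[cite: MoonenZarhin1999LowDim, §2 (2.4) and Thm. (2.7)] [cite: Ribet1983, Thms. 0–3] [cite: Pohlmann1968, Thm. 1] -/
theorem isDivisorGenerated_powSucc_of_isSimple_sevenfold (hs : X.IsSimple) (hX7 : X.dim = 7)
    (h1 : Module.finrank ℚ X.endAlgebra = 1 → ∀ N : ℕ, IsDivisorGenerated (X.powSucc N))
    (h34 : ∀ (φ : X ⟶ X) (d : ℕ), 0 < d → φ ≫ φ = -(d • 𝟙 X) → Module.finrank ℚ X.endAlgebra = 2 →
      3 ≤ eigenMultiplicity X φ (Complex.I * (Real.sqrt d : ℂ)) →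
      3 ≤ eigenMultiplicity X φ (-(Complex.I * (Real.sqrt d : ℂ))) → ∀ N : ℕ, IsDivisorGenerated (X.powSucc N))
    (N : ℕ) : IsDivisorGenerated (X.powSucc N) :=
  isDivisorGenerated_powSucc_of_isSimple_of_prime_of_odd_of_ge_three hs (hX7 ▸ (by norm_num : (7 : ℕ).Prime))
    (hX7 ▸ (by decide : Odd 7)) h1 h34 N

/-- **THE HODGE CONJECTURE FOR ALL POWERS OF EVERY SIMPLE COMPLEX ABELIAN SEVENFOLD with `End⁰(X) ≠ ℚ` and NOT of
unitary type with `k`-signature `(3,4)`/`(4,3)` — UNCONDITIONAL** (`B = D` on the powers by the previous theorem, then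
Lefschetz `(1,1)` via the tree's `hodgeConjectureFor_of_isDivisorGenerated`). The excluded unitary shape is recorded by
the hypothesis `hne34`: for every `φ` with `φ ≫ φ = -d` (`d > 0`) and `dim_ℚ End⁰(X) = 2`, one multiplicity is `≤ 2`.
[cite: MoonenZarhin1999LowDim, §2 Thm. (2.7)] [cite: Ribet1983, Thms. 0–3] [cite: vanGeemen1994HodgeAV, §2.4]
[cite: Deligne2000, §1] -/
theorem hodgeConjectureFor_powSucc_of_isSimple_sevenfold (hs : X.IsSimple) (hX7 : X.dim = 7)
    (hne : Module.finrank ℚ X.endAlgebra ≠ 1)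
    (hne34 : ∀ (φ : X ⟶ X) (d : ℕ), 0 < d → φ ≫ φ = -(d • 𝟙 X) → Module.finrank ℚ X.endAlgebra = 2 →
      eigenMultiplicity X φ (Complex.I * (Real.sqrt d : ℂ)) ≤ 2 ∨
      eigenMultiplicity X φ (-(Complex.I * (Real.sqrt d : ℂ))) ≤ 2) (N : ℕ) :
    HodgeConjectureFor (X.powSucc N).dim (X.powSucc N).X :=
  hodgeConjectureFor_of_isDivisorGenerated _
    (isDivisorGenerated_powSucc_of_isSimple_sevenfold hs hX7 (fun h => absurd h hne)
      (fun φ d hd hφ he2 ha hb N => by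
        exfalso
        rcases hne34 φ d hd hφ he2 with h | h <;> omega) N)

/-- **`B = D` on all powers of EVERY simple complex abelian sevenfold of unitary type with a multiplicity `≤ 2`** (type one
`(1,6)`/`(6,1)` or `(2,5)`/`(5,2)`) — UNCONDITIONAL, hypothesis-free form. [cite: Ribet1983, Thm. 3]
[cite: MoonenZarhin1999LowDim, §2 Thm. (2.7)] [cite: Gordon1997, Thm. 6.3 (3)] -/
theorem AbelianVariety.isDivisorGenerated_powSucc_of_sevenfold_unitary_le_two (X : AbelianVariety ℂ) (φ : X ⟶ X)
    {d : ℕ} (hd : 0 < d) (hφ : φ ≫ φ = -(d • 𝟙 X)) (hE2 : Module.finrank ℚ X.endAlgebra = 2) (hX7 : X.dim = 7)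
    (hle : eigenMultiplicity X φ (Complex.I * (Real.sqrt d : ℂ)) ≤ 2 ∨
      eigenMultiplicity X φ (-(Complex.I * (Real.sqrt d : ℂ))) ≤ 2)
    (hpos : 0 < eigenMultiplicity X φ (Complex.I * (Real.sqrt d : ℂ)) ∧
      0 < eigenMultiplicity X φ (-(Complex.I * (Real.sqrt d : ℂ)))) (N : ℕ) :
    IsDivisorGenerated (X.powSucc N) := by
  have hsum := eigenMultiplicity_add_eigenMultiplicity_neg_eq_dim X φ hd hφ
  by_cases hone : eigenMultiplicity X φ (Complex.I * (Real.sqrt d : ℂ)) = 1 ∨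
      eigenMultiplicity X φ (-(Complex.I * (Real.sqrt d : ℂ))) = 1
  · exact AbelianVariety.isDivisorGenerated_powSucc_of_ribetTypeOne X φ hd hφ hE2 hone (by omega) N
  · simp only [not_or] at hone
    have htwo : eigenMultiplicity X φ (Complex.I * (Real.sqrt d : ℂ)) = 2 ∨
        eigenMultiplicity X φ (-(Complex.I * (Real.sqrt d : ℂ))) = 2 := by omega
    exact AbelianVariety.isDivisorGenerated_powSucc_of_sevenfold_twoFive X φ hd hφ hE2 hX7 htwo N

end Literature.AlgebraicGeometry.HodgeTheory

end
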